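import Mathlib
import Summits.Ventures.PercRepro2.Defs
import Summits.Ventures.PercRepro2.Independence
import Summits.Ventures.PercRepro2.Harris
import Summits.Ventures.PercRepro2.Graph
import Summits.Ventures.PercRepro2.Exploration
import Summits.Ventures.PercRepro2.Events

/-!
# Row 2′RB: Rao–Blackwellised BHK — the conditional correlation inequalities survive conditioning
on the cluster of a third vertex (blind cell PercRepro2, typer-1; mine-a g3 MINE-A.md §18 and
INBOX 2026-08-23T15:26:16Z "the single RB step is the row itself"; lead g11 15:26:45Z
"`RBcross`/`RBsame`/`RB_all` … in the form mine-a posted")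

Setting: roots `s, t`, `Q = {s ↮ t}` (`Qst`), `μ = P(· | Q)`, a third vertex `w` with cluster
`A = C(w)` (`clusterEvent ends w A = {C(w) = A}`), marked vertices `b, o`;
`X̂(A) = μ(X | C(w) = A)` (`condProb`), `π` = the law of `C(w)` under `μ` (`piLaw`).

* **`RBcross`** (`Cov_π(bL̂, oĤ) ≤ 0`, `bL = {b ↔ s}`, `oH = {o ↔ t}`), in mine-a's cleared-by-`P(Q)`
  form: `Σ_A P(Q ∩ {C(w) = A} ∩ bL) · P(Q ∩ {C(w) = A} ∩ oH) / P(Q ∩ {C(w) = A})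
  ≤ P(Q ∩ bL) · P(Q ∩ oH) / P(Q)` (`x / 0 = 0` makes the empty `A` harmless);
* **`RBsame`** (`Cov_π(bL̂, oL̂) ≥ 0`): the same with `oL = {o ↔ s}` and `≥`;
* the mirrors `Cov_π(bĤ, oL̂) ≤ 0`, `Cov_π(bĤ, oĤ) ≥ 0` are the instances with `s, t` swapped
  (`Qst_comm`), so **`RB_all`** quantifies over every finite graph, admissible weights and every
  5-tuple `(o, b, s, t, w)` with `s ≠ t`.

Reading: `RBcross_iff_covPi` / `RBsame_iff_covPi` — under `P(Q) > 0` the rows are literally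
`Cov_π(X̂, Ŷ) ≤ 0` resp. `≥ 0` with `Cov_π` = `covPi` (the law of total probability
`sum_prob_inter_clusterEvent` partitions by `{C(w) = A}`). Why it is not BHK:
`Cov_μ(1_X, 1_Y) = E_π[Cov_μ(1_X, 1_Y | A)] + Cov_π(X̂, Ŷ)`; BHK 1.3/1.4 sign only the sum, the row
signs the between-cluster part on its own (strictly stronger). Census (mine-a, kit j196591):
`n = 6` FULL 0 / 241,920 for each of the four forms, `n = 7` (`m ≤ 12`) 0 / 44,208, exact climbs
0 negatives with minimum exactly 0.
-/

namespace Summit.Ventures.PercRepro2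

namespace RB

open scoped Classical

variable {V : Type*} {E : Type*} [Fintype E] [DecidableEq E] [Fintype V] [DecidableEq V]
  {R : Type*} [Field R] [LinearOrder R] [IsStrictOrderedRing R]

/-! ## Objects -/

section Objects

variable (p : E → R) (ends : E → Sym2 V) (s t w : V)

omit [Fintype E] [DecidableEq E] [Fintype V] [DecidableEq V] in
/-- `Q = {s ↮ t}`, the conditioning event of the row. -/
def Qst : Set (Config E) := (connEvent ends s t)ᶜ

omit [Fintype E] [DecidableEq E] [Fintype V] [DecidableEq V] in
/-- `Q` is symmetric in the roots. -/
lemma Qst_comm : Qst ends t s = Qst ends s t := by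
  ext ω
  simp only [Qst, connEvent, Set.mem_compl_iff, Set.mem_setOf_eq]
  exact not_congr ⟨conn_symm, conn_symm⟩

/-- `Σ_A P(Q ∩ {C(w) = A} ∩ X) · P(Q ∩ {C(w) = A} ∩ Y) / P(Q ∩ {C(w) = A})`: mine-a's
Rao–Blackwell sum (`= P(Q) · E_π[X̂ Ŷ]`). -/
noncomputable def rbSum (X Y : Set (Config E)) : R :=
  ∑ A : Set V, prob p (Qst ends s t ∩ clusterEvent ends w A ∩ X) *
      prob p (Qst ends s t ∩ clusterEvent ends w A ∩ Y) /
    prob p (Qst ends s t ∩ clusterEvent ends w A)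

/-- `π(A) = μ(C(w) = A) = P(Q ∩ {C(w) = A}) / P(Q)`: the law of the third cluster under `μ`. -/
noncomputable def piLaw (A : Set V) : R :=
  prob p (Qst ends s t ∩ clusterEvent ends w A) / prob p (Qst ends s t)

/-- `X̂(A) = μ(X | C(w) = A)`: the conditional probability given the third cluster. -/
noncomputable def condProb (X : Set (Config E)) (A : Set V) : R :=
  prob p (Qst ends s t ∩ clusterEvent ends w A ∩ X) / prob p (Qst ends s t ∩ clusterEvent ends w A)

/-- `E_π[f] = Σ_A π(A) f(A)`. -/
noncomputable def piExpect (f : Set V → R) : R := ∑ A : Set V, piLaw p ends s t w A * f A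

/-- `Cov_π(X̂, Ŷ) = E_π[X̂ Ŷ] − E_π[X̂] E_π[Ŷ]`. -/
noncomputable def covPi (X Y : Set (Config E)) : R :=
  piExpect p ends s t w (fun A => condProb p ends s t w X A * condProb p ends s t w Y A) -
    piExpect p ends s t w (condProb p ends s t w X) * piExpect p ends s t w (condProb p ends s t w Y)

end Objects

/-! ## The rows -/

section Rows

variable (p : E → R) (ends : E → Sym2 V) (o b s t w : V)

/-- **(RB-cross)** `Cov_π(bL̂, oĤ) ≤ 0` (MINE-A.md §18), cleared by `P(Q)`:
`Σ_A P(Q ∩ {C(w) = A} ∩ {b ↔ s}) P(Q ∩ {C(w) = A} ∩ {o ↔ t}) / P(Q ∩ {C(w) = A})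
≤ P(Q ∩ {b ↔ s}) P(Q ∩ {o ↔ t}) / P(Q)`. The mirror `Cov_π(bĤ, oL̂) ≤ 0` is `RBcross p ends o b t s w`. -/
def RBcross : Prop :=
  rbSum p ends s t w (connEvent ends b s) (connEvent ends o t) ≤
    prob p (Qst ends s t ∩ connEvent ends b s) * prob p (Qst ends s t ∩ connEvent ends o t) /
      prob p (Qst ends s t)

/-- **(RB-same)** `Cov_π(bL̂, oL̂) ≥ 0` (MINE-A.md §18), cleared by `P(Q)`:
`P(Q ∩ {b ↔ s}) P(Q ∩ {o ↔ s}) / P(Q)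
≤ Σ_A P(Q ∩ {C(w) = A} ∩ {b ↔ s}) P(Q ∩ {C(w) = A} ∩ {o ↔ s}) / P(Q ∩ {C(w) = A})`.
The mirror `Cov_π(bĤ, oĤ) ≥ 0` is `RBsame p ends o b t s w`. -/
def RBsame : Prop :=
  prob p (Qst ends s t ∩ connEvent ends b s) * prob p (Qst ends s t ∩ connEvent ends o s) /
      prob p (Qst ends s t) ≤
    rbSum p ends s t w (connEvent ends b s) (connEvent ends o s)

end Rows

section Closure

variable (R : Type*) [Field R] [LinearOrder R] [IsStrictOrderedRing R]

/-- **Row 2′RB** over all finite graphs, admissible weights and 5-tuples `(o, b, s, t, w)` with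
`s ≠ t` (both orientations of the roots, hence all four forms of MINE-A.md §18). -/
def RB_all : Prop :=
  ∀ (V E : Type) [Fintype V] [DecidableEq V] [Fintype E] [DecidableEq E]
    (ends : E → Sym2 V) (p : E → R), IsProbVec p →
    ∀ (o b s t w : V), s ≠ t → RBcross p ends o b s t w ∧ RBsame p ends o b s t w

end Closure

/-! ## The conditional-expectation reading -/

section Reading

variable (p : E → R) (ends : E → Sym2 V) (s t w : V)

omit [DecidableEq V] [LinearOrder R] [IsStrictOrderedRing R] in
/-- **Law of total probability over the cluster of `w`**: `Σ_A P(Z ∩ {C(w) = A}) = P(Z)`. -/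
lemma sum_prob_inter_clusterEvent (Z : Set (Config E)) :
    ∑ A : Set V, prob p (Z ∩ clusterEvent ends w A) = prob p Z := by
  unfold prob
  rw [Finset.sum_comm]
  refine Finset.sum_congr rfl fun ω _ => ?_
  rw [Finset.sum_eq_single (cluster ends ω w)]
  · by_cases hZ : ω ∈ Z
    · rw [Set.indicator_of_mem hZ, Set.indicator_of_mem (show ω ∈ Z ∩ clusterEvent ends w _ from ⟨hZ, rfl⟩)]
    · rw [Set.indicator_of_notMem hZ, Set.indicator_of_notMem (fun h => hZ h.1)]
  · intro A _ hA
    apply Set.indicator_of_notMem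
    rintro ⟨_, hA'⟩
    exact hA hA'.symm
  · intro h
    exact absurd (Finset.mem_univ _) h

omit [DecidableEq V] [LinearOrder R] [IsStrictOrderedRing R] in
/-- `Σ_A P(Q ∩ {C(w) = A} ∩ X) = P(Q ∩ X)`. -/
lemma sum_prob_Qst_inter_clusterEvent_inter (X : Set (Config E)) :
    ∑ A : Set V, prob p (Qst ends s t ∩ clusterEvent ends w A ∩ X) = prob p (Qst ends s t ∩ X) := by
  rw [← sum_prob_inter_clusterEvent p ends w]
  refine Finset.sum_congr rfl fun A _ => ?_
  rw [Set.inter_right_comm]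

variable {p}

omit [Fintype V] [DecidableEq V] in
/-- `π(A) X̂(A) = P(Q ∩ {C(w) = A} ∩ X) / P(Q)` (both sides vanish when `P(Q ∩ {C(w) = A}) = 0`). -/
lemma piLaw_mul_condProb (hp : IsProbVec p) (X : Set (Config E)) (A : Set V) :
    piLaw p ends s t w A * condProb p ends s t w X A =
      prob p (Qst ends s t ∩ clusterEvent ends w A ∩ X) / prob p (Qst ends s t) := by
  unfold piLaw condProb
  by_cases h0 : prob p (Qst ends s t ∩ clusterEvent ends w A) = 0
  · have hX : prob p (Qst ends s t ∩ clusterEvent ends w A ∩ X) = 0 :=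
      le_antisymm (h0 ▸ prob_mono hp Set.inter_subset_left) (prob_nonneg hp _)
    rw [h0, hX]
    simp
  · field_simp

omit [Fintype V] [DecidableEq V] in
/-- `π(A) X̂(A) Ŷ(A) = P(Q ∩ {C(w) = A} ∩ X) P(Q ∩ {C(w) = A} ∩ Y) / (P(Q ∩ {C(w) = A}) P(Q))`. -/
lemma piLaw_mul_condProb_mul_condProb (hp : IsProbVec p) (X Y : Set (Config E)) (A : Set V) :
    piLaw p ends s t w A * (condProb p ends s t w X A * condProb p ends s t w Y A) =
      prob p (Qst ends s t ∩ clusterEvent ends w A ∩ X) *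
          prob p (Qst ends s t ∩ clusterEvent ends w A ∩ Y) /
        prob p (Qst ends s t ∩ clusterEvent ends w A) / prob p (Qst ends s t) := by
  unfold piLaw condProb
  by_cases h0 : prob p (Qst ends s t ∩ clusterEvent ends w A) = 0
  · have hX : prob p (Qst ends s t ∩ clusterEvent ends w A ∩ X) = 0 :=
      le_antisymm (h0 ▸ prob_mono hp Set.inter_subset_left) (prob_nonneg hp _)
    rw [h0, hX]
    simp
  · field_simp

omit [DecidableEq V] in
/-- `E_π[X̂] = μ(X) = P(Q ∩ X) / P(Q)` (the tower property). -/
theorem piExpect_condProb (hp : IsProbVec p) (X : Set (Config E)) :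
    piExpect p ends s t w (condProb p ends s t w X) = prob p (Qst ends s t ∩ X) / prob p (Qst ends s t) := by
  unfold piExpect
  simp_rw [piLaw_mul_condProb ends s t w hp X]
  rw [← Finset.sum_div, sum_prob_Qst_inter_clusterEvent_inter]

omit [DecidableEq V] in
/-- `E_π[X̂ Ŷ] = rbSum X Y / P(Q)`. -/
theorem piExpect_condProb_mul_condProb (hp : IsProbVec p) (X Y : Set (Config E)) :
    piExpect p ends s t w (fun A => condProb p ends s t w X A * condProb p ends s t w Y A) =
      rbSum p ends s t w X Y / prob p (Qst ends s t) := by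
  unfold piExpect rbSum
  simp_rw [piLaw_mul_condProb_mul_condProb ends s t w hp X Y]
  rw [Finset.sum_div]

omit [DecidableEq V] in
/-- `Cov_π(X̂, Ŷ) = rbSum X Y / P(Q) − (P(Q ∩ X) / P(Q)) (P(Q ∩ Y) / P(Q))`. -/
theorem covPi_eq (hp : IsProbVec p) (X Y : Set (Config E)) :
    covPi p ends s t w X Y =
      rbSum p ends s t w X Y / prob p (Qst ends s t) -
        prob p (Qst ends s t ∩ X) / prob p (Qst ends s t) *
          (prob p (Qst ends s t ∩ Y) / prob p (Qst ends s t)) := by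
  unfold covPi
  rw [piExpect_condProb_mul_condProb ends s t w hp, piExpect_condProb ends s t w hp,
    piExpect_condProb ends s t w hp]

omit [DecidableEq V] in
/-- With `P(Q) > 0`: `Cov_π(X̂, Ŷ) ≤ 0 ↔ rbSum X Y ≤ P(Q ∩ X) P(Q ∩ Y) / P(Q)`. -/
theorem covPi_nonpos_iff (hp : IsProbVec p) (hQ : 0 < prob p (Qst ends s t)) (X Y : Set (Config E)) :
    covPi p ends s t w X Y ≤ 0 ↔
      rbSum p ends s t w X Y ≤ prob p (Qst ends s t ∩ X) * prob p (Qst ends s t ∩ Y) /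
        prob p (Qst ends s t) := by
  rw [covPi_eq ends s t w hp, sub_nonpos]
  have h : prob p (Qst ends s t ∩ X) / prob p (Qst ends s t) *
      (prob p (Qst ends s t ∩ Y) / prob p (Qst ends s t)) =
      prob p (Qst ends s t ∩ X) * prob p (Qst ends s t ∩ Y) / prob p (Qst ends s t) /
        prob p (Qst ends s t) := by
    field_simp
  rw [h, div_le_div_iff_of_pos_right hQ]

omit [DecidableEq V] in
/-- With `P(Q) > 0`: `0 ≤ Cov_π(X̂, Ŷ) ↔ P(Q ∩ X) P(Q ∩ Y) / P(Q) ≤ rbSum X Y`. -/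
theorem covPi_nonneg_iff (hp : IsProbVec p) (hQ : 0 < prob p (Qst ends s t)) (X Y : Set (Config E)) :
    0 ≤ covPi p ends s t w X Y ↔
      prob p (Qst ends s t ∩ X) * prob p (Qst ends s t ∩ Y) / prob p (Qst ends s t) ≤
        rbSum p ends s t w X Y := by
  rw [covPi_eq ends s t w hp, sub_nonneg]
  have h : prob p (Qst ends s t ∩ X) / prob p (Qst ends s t) *
      (prob p (Qst ends s t ∩ Y) / prob p (Qst ends s t)) =
      prob p (Qst ends s t ∩ X) * prob p (Qst ends s t ∩ Y) / prob p (Qst ends s t) /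
        prob p (Qst ends s t) := by
    field_simp
  rw [h, div_le_div_iff_of_pos_right hQ]

omit [DecidableEq V] in
/-- **(RB-cross) is `Cov_π(bL̂, oĤ) ≤ 0`** (for `P(Q) > 0`). -/
theorem RBcross_iff_covPi (hp : IsProbVec p) (hQ : 0 < prob p (Qst ends s t)) (o b : V) :
    RBcross p ends o b s t w ↔ covPi p ends s t w (connEvent ends b s) (connEvent ends o t) ≤ 0 := by
  unfold RBcross
  rw [covPi_nonpos_iff ends s t w hp hQ]

omit [DecidableEq V] in
/-- **(RB-same) is `Cov_π(bL̂, oL̂) ≥ 0`** (for `P(Q) > 0`). -/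
theorem RBsame_iff_covPi (hp : IsProbVec p) (hQ : 0 < prob p (Qst ends s t)) (o b : V) :
    RBsame p ends o b s t w ↔ 0 ≤ covPi p ends s t w (connEvent ends b s) (connEvent ends o s) := by
  unfold RBsame
  rw [covPi_nonneg_iff ends s t w hp hQ]

omit [DecidableEq V] [IsStrictOrderedRing R] in
/-- `Σ_A π(A) = 1` when `P(Q) > 0`. -/
lemma sum_piLaw (hQ : 0 < prob p (Qst ends s t)) : ∑ A : Set V, piLaw p ends s t w A = 1 := by
  unfold piLaw
  rw [← Finset.sum_div, sum_prob_inter_clusterEvent, div_self hQ.ne']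

omit [DecidableEq V] in
/-- `rbSum X Y ≥ 0`. -/
lemma rbSum_nonneg (hp : IsProbVec p) (X Y : Set (Config E)) : 0 ≤ rbSum p ends s t w X Y :=
  Finset.sum_nonneg fun _ _ =>
    div_nonneg (mul_nonneg (prob_nonneg hp _) (prob_nonneg hp _)) (prob_nonneg hp _)

end Reading

end RB

end Summit.Ventures.PercRepro2
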